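import Literature.Analysis.FluidPDE.CKNEpsilonRegularityAssembly
import HarnessLib

/-!
# Inner approximation of backward parabolic cylinders touching the top of the domain

Analysis/FluidPDE support file for the reduction of Tsai's backward ε-regularity criterion
(`Literature.Analysis.FluidPDE.tsai1998_lemma42`, Tsai 1998, Lemma 4.2:
Caffarelli–Kohn–Nirenberg's Proposition 2 with the *backward* cylinders
`Q_r(t, x) = (t - r², t) × B_r(x)`, valid up to the top of the cylinder on which the solution is
suitable) to the tree's decomposition targets of
the CKN ε-regularity theory (`localEnergyEstimate`, `pressureEstimate`, `interpolationEstimate` of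
`CKNEpsilonRegularityAssembly`, `lemarieRieusset_epsilon_regularity` of `CKNEpsilonRegularity`).
The first two targets are stated for cylinders with `closure Q_r(z) ⊆ Q`; at the top of the
domain one only has `Q_r(z) ⊆ Q`. The passage ("the proof … goes through without change; it
assumes the information only at times previous to `t`", Tsai 1998, p. 46) is an inner
approximation: the cylinders `Q_{σr}(t - δ, x)`, `0 < σ < 1`, `δ = (r² - (σr)²)/2`, have
closure inside `Q_r(t, x)`, their scaled data `A, E, D` are at most `σ⁻¹, σ⁻¹, σ⁻²` times those
of `Q_r(t, x)`, and as `σ ↑ 1` the windows `(t - θ²r², t - δ) × B_{θσr}(x)` exhaust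
`Q_{θr}(t, x)`, so that `E(θr)`, `D(θr)` (continuity of the integral from below) and `A(θr)`
(an essential supremum over an increasing union of time windows of integrals over increasing
balls) are recovered in the limit. This file provides exactly these elementary facts; the estimates
themselves are derived in `CKNTopCylinderEstimates`.

## Contents

* `closure_parabolicCylinder_inner_subset`, `window_subset_parabolicCylinder_inner` — geometry of
  the inner cylinders and windows;
* `cknAEss_le_mul_of_subset`, `cknE_le_mul_of_subset`, `cknD_le_mul_of_subset` — monotonicity of
  the scaled quantities `A` (`cknAEss`, essential supremum in time), `E` (`cknE`), `D` (`cknD`)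
  under inclusion of cylinders, with the factors `r/r'`, `r/r'`, `(r/r')²`;
* `window_essSup_le_cknAEss`, `window_lintegral_le_cknE`, `window_lintegral_le_cknD` — the window
  quantities are minorants of the data of the inner `θ`-cylinders;
* `exists_innerScales` and the `Scales` section — along scales `σₙ ↑ 1` the windows increase
  and exhaust `Q_{θr}(z)` (`iUnion_window`, `iSup_window_lintegral`), and
  `A(θr; z) ≤ ⨆ₙ (window essential suprema)` (`cknAEss_le_iSup_window`).

Everything here is dimension-free except the statements about `cknAEss`, which the tree defines
on `ℝ × ℝ³` (`LocalTypeI`); no notation is introduced (`ℝ³ = EuclideanSpace ℝ (Fin 3)` is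
written out).

## References

* T.-P. Tsai, *On Leray's self-similar solutions of the Navier–Stokes equations satisfying local
  energy estimates*, Arch. Rational Mech. Anal. 143 (1998) 29–51, Lemma 4.2 and the remark
  following it (p. 46). [Tsai1998]
* L. Caffarelli, R. Kohn, L. Nirenberg, *Partial regularity of suitable weak solutions of the
  Navier–Stokes equations*, Comm. Pure Appl. Math. 35 (1982), Proposition 2, §6.
  [CaffarelliKohnNirenberg1982]
-/

noncomputable section

open MeasureTheory Set Function Filter Topology TopologicalSpace Metric
open scoped NNReal ENNReal

namespace Literature.Analysis.FluidPDE

/-! ### Inner cylinders and windows -/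

section InnerCylinders

variable {X : Type*} [PseudoMetricSpace X]

/-- The inner cylinder `Q_{r'}(t - δ, x)`, `r' < r`, `δ = (r² - r'²)/2`, has closure inside
`Q_r(t, x)`: its closed time window is `[t - (r² + r'²)/2, t - δ] ⊆ (t - r², t)`.
[folklore] -/
theorem closure_parabolicCylinder_inner_subset {r r' : ℝ} (hr' : 0 < r') (h : r' < r)
    (z : ℝ × X) :
    closure (parabolicCylinder r' (z.1 - (r ^ 2 - r' ^ 2) / 2, z.2)) ⊆ parabolicCylinder r z := by
  rw [parabolicCylinder, closure_prod_eq]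
  refine prod_mono ?_ ?_
  · refine (isClosed_Icc.closure_subset_iff.2 Ioo_subset_Icc_self).trans ?_
    intro τ hτ
    simp only [mem_Icc] at hτ
    have h2 : r' ^ 2 < r ^ 2 := by nlinarith
    constructor <;> nlinarith [hτ.1, hτ.2]
  · exact closure_ball_subset_closedBall.trans (closedBall_subset_ball h)

/-- The inner cylinder lies inside `Q_r(t, x)`. [folklore] -/
theorem parabolicCylinder_inner_subset {r r' : ℝ} (hr' : 0 < r') (h : r' < r) (z : ℝ × X) :
    parabolicCylinder r' (z.1 - (r ^ 2 - r' ^ 2) / 2, z.2) ⊆ parabolicCylinder r z :=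
  subset_closure.trans (closure_parabolicCylinder_inner_subset hr' h z)

/-- The window used for the lower bounds: for `θ² ≤ 1/2` the set
`(t - θ²r², t - δ) × B_{θr'}(x)` lies in the inner `θ`-cylinder `Q_{θr'}(t - δ, x)`,
`δ = (r² - r'²)/2`. [folklore] -/
theorem window_subset_parabolicCylinder_inner {r r' θ : ℝ} (hθ : θ ^ 2 ≤ 1 / 2)
    (h : r' ≤ r) (hr' : 0 ≤ r') (z : ℝ × X) :
    Ioo (z.1 - (θ * r) ^ 2) (z.1 - (r ^ 2 - r' ^ 2) / 2) ×ˢ ball z.2 (θ * r') ⊆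
      parabolicCylinder (θ * r') (z.1 - (r ^ 2 - r' ^ 2) / 2, z.2) := by
  refine prod_mono (fun τ hτ => ?_) Subset.rfl
  simp only [mem_Ioo] at hτ ⊢
  refine ⟨?_, hτ.2⟩
  have h1 : r' ^ 2 ≤ r ^ 2 := pow_le_pow_left₀ hr' h 2
  nlinarith [hτ.1, sq_nonneg θ]

/-- The time window of the inner cylinder `Q_{r'}(t - δ, x)` lies in that of `Q_r(t, x)`.
[folklore] -/
theorem Ioo_inner_subset {r r' : ℝ} (hr' : 0 < r') (h : r' < r) (t : ℝ) :
    Ioo (t - (r ^ 2 - r' ^ 2) / 2 - r' ^ 2) (t - (r ^ 2 - r' ^ 2) / 2) ⊆ Ioo (t - r ^ 2) t := by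
  intro τ hτ
  simp only [mem_Ioo] at hτ ⊢
  have : r' ^ 2 < r ^ 2 := by nlinarith
  constructor <;> nlinarith [hτ.1, hτ.2]

/-- The truncated `θ`-window lies in the time window of the inner `θ`-cylinder
(`θ² ≤ 1/2`). [folklore] -/
theorem Ioo_window_subset {r r' θ : ℝ} (hθ : θ ^ 2 ≤ 1 / 2) (h : r' ≤ r) (hr' : 0 ≤ r')
    (t : ℝ) :
    Ioo (t - (θ * r) ^ 2) (t - (r ^ 2 - r' ^ 2) / 2) ⊆
      Ioo (t - (r ^ 2 - r' ^ 2) / 2 - (θ * r') ^ 2) (t - (r ^ 2 - r' ^ 2) / 2) := by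
  intro τ hτ
  simp only [mem_Ioo] at hτ ⊢
  refine ⟨?_, hτ.2⟩
  have h1 : r' ^ 2 ≤ r ^ 2 := pow_le_pow_left₀ hr' h 2
  nlinarith [hτ.1, sq_nonneg θ]

end InnerCylinders

/-! ### Monotonicity of the scaled quantities under inclusion of cylinders -/

section Monotone

/-- `(r')⁻¹ = (r/r') · r⁻¹` in `ℝ≥0∞` for `0 < r'`, `0 < r`. [folklore] -/
theorem ENNReal.inv_ofReal_eq_mul {r r' : ℝ} (hr : 0 < r) (hr' : 0 < r') :
    (ENNReal.ofReal r')⁻¹ = ENNReal.ofReal (r / r') * (ENNReal.ofReal r)⁻¹ := by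
  rw [ENNReal.ofReal_div_of_pos hr', div_eq_mul_inv, mul_comm (ENNReal.ofReal r), mul_assoc,
    ENNReal.mul_inv_cancel ((ENNReal.ofReal_pos.2 hr).ne') ENNReal.ofReal_ne_top, mul_one]

variable {E : Type*} [NormedAddCommGroup E] [InnerProductSpace ℝ E] [FiniteDimensional ℝ E]
  [MeasurableSpace E] [BorelSpace E]

/-- Scaled dissipation under inclusion: `E(r'; z') ≤ (r/r') E(r; z)` if `Q_{r'}(z') ⊆ Q_r(z)`.
[folklore] -/
theorem cknE_le_mul_of_subset {r r' : ℝ} {z z' : ℝ × E} (hr : 0 < r) (hr' : 0 < r')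
    (h : parabolicCylinder r' z' ⊆ parabolicCylinder r z) (G : ℝ → E → E →L[ℝ] E) :
    cknE r' z' G ≤ ENNReal.ofReal (r / r') * cknE r z G := by
  rw [cknE, cknE, ENNReal.inv_ofReal_eq_mul hr hr', mul_assoc]
  exact mul_le_mul_right (mul_le_mul_right (lintegral_mono_set h) _) _

/-- Scaled pressure under inclusion: `D(r'; z') ≤ (r/r')² D(r; z)` if `Q_{r'}(z') ⊆ Q_r(z)`.
[folklore] -/
theorem cknD_le_mul_of_subset {r r' : ℝ} {z z' : ℝ × E} (hr : 0 < r) (hr' : 0 < r')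
    (h : parabolicCylinder r' z' ⊆ parabolicCylinder r z) (p : ℝ → E → ℝ) :
    cknD r' z' p ≤ ENNReal.ofReal (r / r') ^ 2 * cknD r z p := by
  have e : (ENNReal.ofReal r' ^ 2)⁻¹ =
      ENNReal.ofReal (r / r') ^ 2 * (ENNReal.ofReal r ^ 2)⁻¹ := by
    rw [ENNReal.inv_pow, ENNReal.inv_ofReal_eq_mul hr hr', mul_pow, ← ENNReal.inv_pow]
  rw [cknD, cknD, e, mul_assoc]
  exact mul_le_mul_right (mul_le_mul_right (lintegral_mono_set h) _) _

/-- Lower bound for the dissipation of the inner `θ`-cylinder by a window integral: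
`(θr)⁻¹ ∫∫_V |G|² ≤ E(θr'; z')` for `V ⊆ Q_{θr'}(z')`, `r' ≤ r`. [folklore] -/
theorem window_lintegral_le_cknE {r r' θ : ℝ} {z' : ℝ × E} {V : Set (ℝ × E)} (hθ : 0 < θ)
    (h : r' ≤ r) (hV : V ⊆ parabolicCylinder (θ * r') z') (G : ℝ → E → E →L[ℝ] E) :
    (ENNReal.ofReal (θ * r))⁻¹ * ∫⁻ w in V, ENNReal.ofReal (frobeniusNormSq (G w.1 w.2)) ≤
      cknE (θ * r') z' G := by
  rw [cknE]
  refine mul_le_mul' ?_ (lintegral_mono_set hV)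
  exact ENNReal.inv_le_inv.2 (ENNReal.ofReal_le_ofReal (by nlinarith))

/-- Lower bound for the pressure quantity of the inner `θ`-cylinder by a window integral.
[folklore] -/
theorem window_lintegral_le_cknD {r r' θ : ℝ} {z' : ℝ × E} {V : Set (ℝ × E)} (hθ : 0 < θ)
    (h : r' ≤ r) (hV : V ⊆ parabolicCylinder (θ * r') z') (p : ℝ → E → ℝ) :
    (ENNReal.ofReal (θ * r) ^ 2)⁻¹ * ∫⁻ w in V, ‖p w.1 w.2‖ₑ ^ (3 / 2 : ℝ) ≤
      cknD (θ * r') z' p := by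
  rw [cknD]
  refine mul_le_mul' ?_ (lintegral_mono_set hV)
  refine ENNReal.inv_le_inv.2 (pow_le_pow_left' (ENNReal.ofReal_le_ofReal (by nlinarith)) 2)

variable {z z' : ℝ × EuclideanSpace ℝ (Fin 3)}

/-- Scaled energy under inclusion: `A(r'; z') ≤ (r/r') A(r; z)` when the time window and the
ball of `Q_{r'}(z')` lie in those of `Q_r(z)` (`A = cknAEss`, essential supremum in time).
[folklore] -/
theorem cknAEss_le_mul_of_subset {r r' : ℝ} (hr : 0 < r) (hr' : 0 < r')
    (hI : Ioo (z'.1 - r' ^ 2) z'.1 ⊆ Ioo (z.1 - r ^ 2) z.1) (hB : ball z'.2 r' ⊆ ball z.2 r)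
    (u : ℝ → EuclideanSpace ℝ (Fin 3) → EuclideanSpace ℝ (Fin 3)) :
    cknAEss r' z' u ≤ ENNReal.ofReal (r / r') * cknAEss r z u := by
  rw [cknAEss, cknAEss, ← ENNReal.essSup_const_mul]
  calc essSup (fun t => (ENNReal.ofReal r')⁻¹ * ∫⁻ x in ball z'.2 r', ‖u t x‖ₑ ^ 2)
        (volume.restrict (Ioo (z'.1 - r' ^ 2) z'.1))
      ≤ essSup (fun t => ENNReal.ofReal (r / r') *
          ((ENNReal.ofReal r)⁻¹ * ∫⁻ x in ball z.2 r, ‖u t x‖ₑ ^ 2))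
          (volume.restrict (Ioo (z'.1 - r' ^ 2) z'.1)) := by
        refine essSup_mono_ae (Eventually.of_forall fun t => ?_)
        simp only
        rw [ENNReal.inv_ofReal_eq_mul hr hr', mul_assoc]
        exact mul_le_mul_right (mul_le_mul_right (lintegral_mono_set hB) _) _
    _ ≤ _ := essSup_mono_measure
          (Measure.absolutelyContinuous_of_le (Measure.restrict_mono hI le_rfl))

/-- Lower bound for the scaled energy of the inner `θ`-cylinder `Q_{θr'}(t - δ, x)`: the
essential supremum, over the sub-window `(t - θ²r², t - δ)`, of `(θr)⁻¹ ∫_{B_{θr'}(x)} |u|²`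
is at most `A(θr'; (t - δ, x))`. [folklore] -/
theorem window_essSup_le_cknAEss {r r' θ δ : ℝ} (hθ : 0 < θ) (h : r' ≤ r)
    (hI : Ioo (z.1 - (θ * r) ^ 2) (z.1 - δ) ⊆ Ioo (z.1 - δ - (θ * r') ^ 2) (z.1 - δ))
    (u : ℝ → EuclideanSpace ℝ (Fin 3) → EuclideanSpace ℝ (Fin 3)) :
    essSup ((Ioo (z.1 - (θ * r) ^ 2) (z.1 - δ)).indicator fun t =>
        (ENNReal.ofReal (θ * r))⁻¹ * ∫⁻ x in ball z.2 (θ * r'), ‖u t x‖ₑ ^ 2)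
        (volume.restrict (Ioo (z.1 - (θ * r) ^ 2) z.1)) ≤
      cknAEss (θ * r') (z.1 - δ, z.2) u := by
  rw [ENNReal.essSup_indicator_eq_essSup_restrict measurableSet_Ioo, Measure.restrict_restrict
    measurableSet_Ioo, cknAEss]
  have hsub : Ioo (z.1 - (θ * r) ^ 2) (z.1 - δ) ∩ Ioo (z.1 - (θ * r) ^ 2) z.1 ⊆
      Ioo ((z.1 - δ, z.2).1 - (θ * r') ^ 2) (z.1 - δ, z.2).1 :=
    inter_subset_left.trans hI
  calc essSup (fun t =>
          (ENNReal.ofReal (θ * r))⁻¹ * ∫⁻ x in ball z.2 (θ * r'), ‖u t x‖ₑ ^ 2)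
        (volume.restrict (Ioo (z.1 - (θ * r) ^ 2) (z.1 - δ) ∩ Ioo (z.1 - (θ * r) ^ 2) z.1))
      ≤ essSup (fun t =>
          (ENNReal.ofReal (θ * r'))⁻¹ * ∫⁻ x in ball z.2 (θ * r'), ‖u t x‖ₑ ^ 2)
        (volume.restrict
          (Ioo (z.1 - (θ * r) ^ 2) (z.1 - δ) ∩ Ioo (z.1 - (θ * r) ^ 2) z.1)) := by
        refine essSup_mono_ae (Eventually.of_forall fun t => ?_)
        refine mul_le_mul_left ?_ _
        exact ENNReal.inv_le_inv.2 (ENNReal.ofReal_le_ofReal (by nlinarith))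
    _ ≤ _ := essSup_mono_measure
          (Measure.absolutelyContinuous_of_le (Measure.restrict_mono hsub le_rfl))

end Monotone

/-! ### Inner scales `σₙ ↑ 1` and the exhausting windows -/

section Scales

/-- There is a sequence of scales `σₙ ∈ (0, 1)` increasing to `1` (e.g. `σₙ = (n+1)/(n+2)`).
[folklore] -/
theorem exists_innerScales :
    ∃ σ : ℕ → ℝ, (∀ n, 0 < σ n) ∧ (∀ n, σ n < 1) ∧ Monotone σ ∧ Tendsto σ atTop (𝓝 1) := by
  refine ⟨fun n => 1 - 1 / ((n : ℝ) + 2), fun n => ?_, fun n => ?_, fun m n hmn => ?_, ?_⟩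
  · have : (1 : ℝ) / ((n : ℝ) + 2) < 1 := by
      rw [div_lt_one (by positivity)]
      linarith [n.cast_nonneg (α := ℝ)]
    linarith
  · have : (0 : ℝ) < 1 / ((n : ℝ) + 2) := by positivity
    linarith
  · have : (1 : ℝ) / ((n : ℝ) + 2) ≤ 1 / ((m : ℝ) + 2) :=
      one_div_le_one_div_of_le (by positivity) (by exact_mod_cast Nat.add_le_add_right hmn 2)
    dsimp only
    linarith
  · have h : Tendsto (fun n : ℕ => 1 - 1 / ((n : ℝ) + 2)) atTop (𝓝 (1 - 0)) := by
      refine tendsto_const_nhds.sub ?_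
      have h1 := tendsto_one_div_add_atTop_nhds_zero_nat (𝕜 := ℝ)
      have h2 : Tendsto (fun n : ℕ => n + 1) atTop atTop := tendsto_add_atTop_nat 1
      convert h1.comp h2 using 2 with n
      simp only [comp_apply, Nat.cast_add, Nat.cast_one]
      ring
    rwa [sub_zero] at h

variable {σ : ℕ → ℝ} {r : ℝ}

/-- The inverse scales tend to `1` in `ℝ≥0∞`. [folklore] -/
theorem tendsto_ofReal_inv_scales (hσt : Tendsto σ atTop (𝓝 1)) :
    Tendsto (fun n => ENNReal.ofReal (σ n)⁻¹) atTop (𝓝 1) := by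
  have h := hσt.inv₀ one_ne_zero
  rw [inv_one] at h
  have := ENNReal.tendsto_ofReal h
  rwa [ENNReal.ofReal_one] at this

/-- The time gaps `δₙ = (r² - (σₙ r)²)/2` are positive. [folklore] -/
theorem innerGap_pos (hσ0 : ∀ n, 0 < σ n) (hσ1 : ∀ n, σ n < 1) (hr : 0 < r) (n : ℕ) :
    0 < (r ^ 2 - (σ n * r) ^ 2) / 2 := by
  have h1 := hσ1 n
  have h0 := hσ0 n
  have hs2 : σ n ^ 2 < 1 := by nlinarith
  have : (σ n * r) ^ 2 < r ^ 2 := by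
    rw [mul_pow]
    nlinarith [pow_pos hr 2]
  linarith

/-- The time gaps are antitone in `n`. [folklore] -/
theorem antitone_innerGap (hσ0 : ∀ n, 0 < σ n) (hσm : Monotone σ) (hr : 0 < r) :
    Antitone fun n => (r ^ 2 - (σ n * r) ^ 2) / 2 := by
  intro m n hmn
  have h := hσm hmn
  have h0 := hσ0 m
  dsimp only
  have : (σ m * r) ^ 2 ≤ (σ n * r) ^ 2 :=
    pow_le_pow_left₀ (by positivity) (mul_le_mul_of_nonneg_right h hr.le) 2
  linarith

/-- The time gaps tend to `0`: every `ε > 0` eventually exceeds them. [folklore] -/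
theorem eventually_innerGap_lt (hσt : Tendsto σ atTop (𝓝 1)) (r : ℝ) {ε : ℝ}
    (hε : 0 < ε) :
    ∀ᶠ n in atTop, (r ^ 2 - (σ n * r) ^ 2) / 2 < ε := by
  have h : Tendsto (fun n => (r ^ 2 - (σ n * r) ^ 2) / 2) atTop
      (𝓝 ((r ^ 2 - (1 * r) ^ 2) / 2)) :=
    ((tendsto_const_nhds.sub ((hσt.mul_const r).pow 2)).div_const 2)
  rw [one_mul, sub_self, zero_div] at h
  exact (tendsto_order.1 h).2 ε hε

/-- The truncated time windows exhaust the full window. [folklore] -/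
theorem iUnion_Ioo_innerGap (hσ0 : ∀ n, 0 < σ n) (hσ1 : ∀ n, σ n < 1)
    (hσt : Tendsto σ atTop (𝓝 1)) (hr : 0 < r) (a t : ℝ) :
    ⋃ n, Ioo a (t - (r ^ 2 - (σ n * r) ^ 2) / 2) = Ioo a t := by
  ext τ
  simp only [mem_iUnion, mem_Ioo]
  constructor
  · rintro ⟨n, h1, h2⟩
    exact ⟨h1, by linarith [innerGap_pos hσ0 hσ1 hr n]⟩
  · rintro ⟨h1, h2⟩
    obtain ⟨n, hn⟩ := (eventually_innerGap_lt hσt r (sub_pos.2 h2)).exists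
    exact ⟨n, h1, by linarith⟩

/-- The inner balls exhaust the ball. [folklore] -/
theorem iUnion_ball_scales {X : Type*} [PseudoMetricSpace X] (hσ1 : ∀ n, σ n < 1)
    (hσt : Tendsto σ atTop (𝓝 1)) {θ : ℝ} (hθ : 0 < θ) (hr : 0 < r) (x : X) :
    ⋃ n, ball x (θ * (σ n * r)) = ball x (θ * r) := by
  ext y
  simp only [mem_iUnion, mem_ball]
  constructor
  · rintro ⟨n, hn⟩
    refine hn.trans_le ?_
    have := hσ1 n
    nlinarith [mul_pos hθ hr]
  · intro hy
    have hθr : 0 < θ * r := mul_pos hθ hr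
    have hc : dist y x / (θ * r) < 1 := (div_lt_one hθr).2 hy
    obtain ⟨n, hn⟩ := (hσt.eventually_const_lt hc).exists
    refine ⟨n, ?_⟩
    rw [div_lt_iff₀ hθr] at hn
    linarith

variable {X : Type*} [PseudoMetricSpace X]

/-- The windows `Vₙ = (t - θ²r², t - δₙ) × B_{θ σₙ r}(x)` increase with `n`.
[folklore] -/
theorem monotone_window (hσ0 : ∀ n, 0 < σ n) (hσm : Monotone σ) (hr : 0 < r) {θ : ℝ}
    (hθ : 0 < θ) (z : ℝ × X) :
    Monotone fun n => Ioo (z.1 - (θ * r) ^ 2) (z.1 - (r ^ 2 - (σ n * r) ^ 2) / 2) ×ˢ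
      ball z.2 (θ * (σ n * r)) := by
  intro m n hmn
  refine prod_mono (Ioo_subset_Ioo_right ?_) (ball_subset_ball ?_)
  · linarith [antitone_innerGap hσ0 hσm hr hmn]
  · exact mul_le_mul_of_nonneg_left (mul_le_mul_of_nonneg_right (hσm hmn) hr.le) hθ.le

/-- The windows exhaust the `θ`-cylinder `Q_{θr}(z)`. [folklore] -/
theorem iUnion_window (hσ0 : ∀ n, 0 < σ n) (hσ1 : ∀ n, σ n < 1) (hσm : Monotone σ)
    (hσt : Tendsto σ atTop (𝓝 1)) (hr : 0 < r) {θ : ℝ} (hθ : 0 < θ) (z : ℝ × X) :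
    ⋃ n, Ioo (z.1 - (θ * r) ^ 2) (z.1 - (r ^ 2 - (σ n * r) ^ 2) / 2) ×ˢ
      ball z.2 (θ * (σ n * r)) = parabolicCylinder (θ * r) z := by
  rw [iUnion_prod_of_monotone, iUnion_Ioo_innerGap hσ0 hσ1 hσt hr,
    iUnion_ball_scales hσ1 hσt hθ hr, parabolicCylinder]
  · exact fun m n hmn => Ioo_subset_Ioo_right (by linarith [antitone_innerGap hσ0 hσm hr hmn])
  · exact fun m n hmn => ball_subset_ball (mul_le_mul_of_nonneg_left
      (mul_le_mul_of_nonneg_right (hσm hmn) hr.le) hθ.le)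

variable [MeasurableSpace X]

/-- Window integrals exhaust the integral over the `θ`-cylinder (continuity from below).
[folklore] -/
theorem iSup_window_lintegral (hσ0 : ∀ n, 0 < σ n) (hσ1 : ∀ n, σ n < 1) (hσm : Monotone σ)
    (hσt : Tendsto σ atTop (𝓝 1)) (hr : 0 < r) {θ : ℝ} (hθ : 0 < θ) (z : ℝ × X)
    (μ : Measure (ℝ × X)) (F : ℝ × X → ℝ≥0∞) :
    ⨆ n, ∫⁻ w in Ioo (z.1 - (θ * r) ^ 2) (z.1 - (r ^ 2 - (σ n * r) ^ 2) / 2) ×ˢ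
      ball z.2 (θ * (σ n * r)), F w ∂μ =
      ∫⁻ w in parabolicCylinder (θ * r) z, F w ∂μ := by
  rw [← iUnion_window hσ0 hσ1 hσm hσt hr hθ z, setLIntegral_iUnion_of_directed]
  exact (monotone_window hσ0 hσm hr hθ z).directed_le

/-- The window integrals are monotone in `n`. [folklore] -/
theorem monotone_window_lintegral (hσ0 : ∀ n, 0 < σ n) (hσm : Monotone σ) (hr : 0 < r)
    {θ : ℝ} (hθ : 0 < θ) (z : ℝ × X) (μ : Measure (ℝ × X))
    (F : ℝ × X → ℝ≥0∞) :
    Monotone fun n => ∫⁻ w in Ioo (z.1 - (θ * r) ^ 2) (z.1 - (r ^ 2 - (σ n * r) ^ 2) / 2) ×ˢ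
      ball z.2 (θ * (σ n * r)), F w ∂μ :=
  fun _ _ hmn => lintegral_mono_set (monotone_window hσ0 hσm hr hθ z hmn)

end Scales

section ScalesEnergy

variable {σ : ℕ → ℝ} {r : ℝ}

/-- **Semicontinuity of the scaled energy under inner approximation**: `A(θr; z)` is at most
the supremum over `n` of the essential suprema, over the truncated windows
`(t - θ²r², t - δₙ)`, of `(θr)⁻¹ ∫_{B_{θ σₙ r}(x)} |u|²` (monotone convergence on the balls, and
every time `τ < t` of the window eventually lies below `t - δₙ`). [folklore] -/
theorem cknAEss_le_iSup_window (hσ1 : ∀ n, σ n < 1) (hσm : Monotone σ)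
    (hσt : Tendsto σ atTop (𝓝 1)) (hr : 0 < r) {θ : ℝ} (hθ : 0 < θ)
    (z : ℝ × EuclideanSpace ℝ (Fin 3))
    (u : ℝ → EuclideanSpace ℝ (Fin 3) → EuclideanSpace ℝ (Fin 3)) :
    cknAEss (θ * r) z u ≤ ⨆ n, essSup ((Ioo (z.1 - (θ * r) ^ 2)
        (z.1 - (r ^ 2 - (σ n * r) ^ 2) / 2)).indicator fun t =>
          (ENNReal.ofReal (θ * r))⁻¹ *
            ∫⁻ x in ball z.2 (θ * (σ n * r)), ‖u t x‖ₑ ^ 2)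
        (volume.restrict (Ioo (z.1 - (θ * r) ^ 2) z.1)) := by
  set I : Set ℝ := Ioo (z.1 - (θ * r) ^ 2) z.1 with hI
  set g : ℕ → ℝ → ℝ≥0∞ := fun n => (Ioo (z.1 - (θ * r) ^ 2)
      (z.1 - (r ^ 2 - (σ n * r) ^ 2) / 2)).indicator fun t =>
        (ENNReal.ofReal (θ * r))⁻¹ * ∫⁻ x in ball z.2 (θ * (σ n * r)), ‖u t x‖ₑ ^ 2
    with hg
  have hae : ∀ᵐ τ ∂(volume.restrict I), ∀ n, g n τ ≤ essSup (g n) (volume.restrict I) :=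
    ae_all_iff.2 fun n => ENNReal.ae_le_essSup _
  rw [cknAEss]
  refine essSup_le_of_ae_le _ ?_
  filter_upwards [hae, ae_restrict_mem measurableSet_Ioo] with τ hτ hτI
  have hmono : Monotone fun n => ball z.2 (θ * (σ n * r)) := fun m n hmn =>
    ball_subset_ball (mul_le_mul_of_nonneg_left
      (mul_le_mul_of_nonneg_right (hσm hmn) hr.le) hθ.le)
  have hball : ∫⁻ x in ball z.2 (θ * r), ‖u τ x‖ₑ ^ 2 =
      ⨆ n, ∫⁻ x in ball z.2 (θ * (σ n * r)), ‖u τ x‖ₑ ^ 2 := by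
    rw [← iUnion_ball_scales hσ1 hσt hθ hr z.2,
      setLIntegral_iUnion_of_directed _ hmono.directed_le]
  rw [hball, ENNReal.mul_iSup]
  refine iSup_le fun n => ?_
  -- a later index `m ≥ n` whose truncated window contains `τ`
  obtain ⟨m, hmn, hm⟩ := ((eventually_ge_atTop n).and
    (eventually_innerGap_lt hσt r (sub_pos.2 hτI.2))).exists
  have hτm : τ ∈ Ioo (z.1 - (θ * r) ^ 2) (z.1 - (r ^ 2 - (σ m * r) ^ 2) / 2) :=
    ⟨hτI.1, by linarith⟩
  calc (ENNReal.ofReal (θ * r))⁻¹ * ∫⁻ x in ball z.2 (θ * (σ n * r)), ‖u τ x‖ₑ ^ 2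
      ≤ (ENNReal.ofReal (θ * r))⁻¹ *
          ∫⁻ x in ball z.2 (θ * (σ m * r)), ‖u τ x‖ₑ ^ 2 :=
        mul_le_mul_right (lintegral_mono_set (hmono hmn)) _
    _ = g m τ := by rw [hg]; simp only; rw [indicator_of_mem hτm]
    _ ≤ essSup (g m) (volume.restrict I) := hτ m
    _ ≤ ⨆ k, essSup (g k) (volume.restrict I) := le_iSup (fun k => essSup (g k) _) m

/-- The window essential suprema are monotone in `n`. [folklore] -/
theorem monotone_window_essSup (hσ0 : ∀ n, 0 < σ n) (hσm : Monotone σ) (hr : 0 < r) {θ : ℝ}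
    (hθ : 0 < θ) (z : ℝ × EuclideanSpace ℝ (Fin 3))
    (u : ℝ → EuclideanSpace ℝ (Fin 3) → EuclideanSpace ℝ (Fin 3)) :
    Monotone fun n => essSup ((Ioo (z.1 - (θ * r) ^ 2)
        (z.1 - (r ^ 2 - (σ n * r) ^ 2) / 2)).indicator fun t =>
          (ENNReal.ofReal (θ * r))⁻¹ *
            ∫⁻ x in ball z.2 (θ * (σ n * r)), ‖u t x‖ₑ ^ 2)
        (volume.restrict (Ioo (z.1 - (θ * r) ^ 2) z.1)) := by
  intro m n hmn
  refine essSup_mono_ae (Eventually.of_forall fun τ => ?_)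
  refine indicator_le_indicator_of_subset (Ioo_subset_Ioo_right ?_) (fun _ => zero_le) _
    |>.trans (indicator_le_indicator ?_)
  · linarith [antitone_innerGap hσ0 hσm hr hmn]
  · exact mul_le_mul_right (lintegral_mono_set (ball_subset_ball (mul_le_mul_of_nonneg_left
      (mul_le_mul_of_nonneg_right (hσm hmn) hr.le) hθ.le))) _

end ScalesEnergy

end Literature.Analysis.FluidPDE

end
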